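import Literature.Geometry.Kaehler.RiemannSurfaceEndsComplex
import Literature.Geometry.Kaehler.RiemannSurfaceSeparating
import Mathlib.Analysis.Calculus.Deriv.Mul
import Mathlib.Analysis.Calculus.Deriv.Pow
import HarnessLib

/-!
# A holomorphic function of polynomial growth separating a fibre of a finite branched covering of `ℂ`

Layer `Literature/Geometry/Kaehler`, the function-theoretic heart of the curve case of Riemann's
existence theorem (Forster, *Lectures on Riemann Surfaces*, §8 Thm. 8.3 / §14 Thm. 14.12 road;
SGA1 XII Thm. 5.1 in dimension `1`). Let `T` be a Riemann surface and `D : EndsDatum T` holomorphic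
ends data (`RiemannSurfaceEndsComplex`): a proper holomorphic `F : T → ℂ` with finite fibres which is
a finite holomorphic covering over `{R < |z|}`, so that `T` embeds in the compact Riemann surface
`T̄ = D.Cpt` (`inl`) with finitely many new points `∞_K`. For every value `c₀` there is
(`EndsDatum.exists_continuous_injOn_growth`) a CONTINUOUS `h : T → ℂ`, holomorphic at every point
outside a finite set `P`, INJECTIVE on the fibre `F⁻¹{c₀}`, and of POLYNOMIAL GROWTH
`|h| ≤ C₀ (1 + |F|)^K`.

Proof: the compact Riemann surface `T̄` carries a meromorphic function `g` separating the (finite)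
set `inl(F⁻¹{c₀})`, holomorphic there and at the new points, with poles of order `≤ N_p` at finitely
many old points `p` (`RiemannSurface.exists_mdifferentiable_injOn`, from Cartan–Serre finiteness);
`h := (g ∘ inl) · ∏_p (F − F(p))^{N_p + 1}` (and `0` at the poles) kills the poles (`F` is
holomorphic, so `|F − F(p)| ≲ |ζ_p|`), is still injective on the fibre (the product is a non-zero
constant there), and has polynomial growth in `F` because `g` is bounded near the new points
(compactness of `T̄`).

Everything is proved; there are no definitions.

## References

* O. Forster, *Lectures on Riemann Surfaces*, GTM 81, Springer (1981), §8 Thm. 8.3, §14 Thm. 14.12.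
  [Forster1981]
* A. Grothendieck, M. Raynaud, *SGA 1*, Exp. XII Thm. 5.1. [SGA1]
-/

noncomputable section

open scoped Manifold ContDiff Topology
open Set Filter Function Complex

namespace Literature.Geometry.Kaehler

namespace RiemannSurface

variable {T : Type*} [TopologicalSpace T] [ChartedSpace ℂ T] [IsManifold 𝓘(ℂ, ℂ) ω T]

/-! ### Killing a pole of controlled order -/

/-- **A holomorphic function is Lipschitz at a point in the chart coordinate**: `|F(t) − F(p₀)| ≤ C' |ζ(t)|`
near `p₀`. [folklore] -/
theorem eventually_norm_sub_le_coord {F : T → ℂ} {p₀ : T} (hF : MDifferentiableAt 𝓘(ℂ, ℂ) 𝓘(ℂ, ℂ) F p₀) :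
    ∃ C' : ℝ, 0 ≤ C' ∧ ∀ᶠ t in 𝓝 p₀, ‖F t - F p₀‖ ≤ C' * ‖coord p₀ t‖ := by
  have hG := differentiableAt_comp_symm (mem_chart_source ℂ p₀) hF
  obtain ⟨C', hC'⟩ := hG.isBigO_sub.bound
  refine ⟨max C' 0, le_max_right _ _, ?_⟩
  have h1 := ((chartAt ℂ p₀).continuousAt (mem_chart_source ℂ p₀)).eventually hC'
  have h2 : ∀ᶠ t in 𝓝 p₀, t ∈ (chartAt ℂ p₀).source := (chartAt ℂ p₀).open_source.mem_nhds (mem_chart_source ℂ p₀)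
  filter_upwards [h1, h2] with t ht hts
  simp only [comp_apply, (chartAt ℂ p₀).left_inv hts, (chartAt ℂ p₀).left_inv (mem_chart_source ℂ p₀)] at ht
  refine ht.trans ?_
  rw [coord]
  exact mul_le_mul_of_nonneg_right (le_max_left _ _) (norm_nonneg _)

/-- **Killing a pole**: if `|g| ≤ C |ζ|^{-N}` on a punctured neighbourhood of `p₀` and `F` is holomorphic
at `p₀`, then `g · (F − F(p₀))^{N+1} · π' → 0` at `p₀` for every `π'` continuous at `p₀`. [folklore] -/
theorem tendsto_zero_of_pole_bound {g F π' : T → ℂ} {p₀ : T} {C : ℝ} {N : ℕ}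
    (hg : ∀ᶠ t in 𝓝[≠] p₀, ‖g t‖ ≤ C * ‖coord p₀ t‖⁻¹ ^ N) (hF : MDifferentiableAt 𝓘(ℂ, ℂ) 𝓘(ℂ, ℂ) F p₀)
    (hπ' : ContinuousAt π' p₀) :
    Tendsto (fun t ↦ g t * ((F t - F p₀) ^ (N + 1) * π' t)) (𝓝[≠] p₀) (𝓝 0) := by
  obtain ⟨C', hC'0, hC'⟩ := eventually_norm_sub_le_coord hF
  set B := ‖π' p₀‖ + 1 with hB
  have hB0 : 0 ≤ B := by positivity
  have hπB : ∀ᶠ t in 𝓝 p₀, ‖π' t‖ ≤ B := by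
    have h := hπ'.norm.eventually_lt continuousAt_const (lt_add_one ‖π' p₀‖)
    exact h.mono fun t ht ↦ ht.le
  -- the chart coordinate does not vanish on a punctured neighbourhood
  have hζ : ∀ᶠ t in 𝓝[≠] p₀, coord p₀ t ≠ 0 := by
    have h1 : ∀ᶠ t in 𝓝[≠] p₀, t ∈ (chartAt ℂ p₀).source :=
      mem_nhdsWithin_of_mem_nhds ((chartAt ℂ p₀).open_source.mem_nhds (mem_chart_source ℂ p₀))
    filter_upwards [h1, eventually_mem_nhdsWithin] with t ht hne
    intro h0
    rw [coord, sub_eq_zero] at h0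
    exact hne ((chartAt ℂ p₀).injOn ht (mem_chart_source ℂ p₀) h0)
  set M := max C 0 * C' ^ N * B with hM
  have hbound : ∀ᶠ t in 𝓝[≠] p₀, ‖g t * ((F t - F p₀) ^ (N + 1) * π' t)‖ ≤ M * ‖F t - F p₀‖ := by
    filter_upwards [hg, hζ, mem_nhdsWithin_of_mem_nhds hC', mem_nhdsWithin_of_mem_nhds hπB] with t hgt hζt hFt hπt
    set a := ‖coord p₀ t‖ with ha
    set d := ‖F t - F p₀‖ with hd
    have ha0 : 0 < a := norm_pos_iff.2 hζt
    have hgt' : ‖g t‖ ≤ max C 0 * a⁻¹ ^ N :=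
      hgt.trans (mul_le_mul_of_nonneg_right (le_max_left _ _) (by positivity))
    have hdN : d ^ (N + 1) ≤ (C' * a) ^ N * d := by
      rw [pow_succ]
      exact mul_le_mul_of_nonneg_right (pow_le_pow_left₀ (norm_nonneg _) hFt N) (norm_nonneg _)
    have hainv : a⁻¹ ^ N * (C' * a) ^ N = C' ^ N := by
      rw [mul_pow, mul_left_comm, ← mul_pow, inv_mul_cancel₀ ha0.ne', one_pow, mul_one]
    rw [norm_mul, norm_mul, norm_pow]
    calc ‖g t‖ * (d ^ (N + 1) * ‖π' t‖)
        ≤ (max C 0 * a⁻¹ ^ N) * ((C' * a) ^ N * d * B) :=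
          mul_le_mul hgt' (mul_le_mul hdN hπt (norm_nonneg _) (by positivity)) (by positivity) (by positivity)
      _ = max C 0 * (a⁻¹ ^ N * (C' * a) ^ N) * B * d := by ring
      _ = M * d := by rw [hainv, hM]
  refine squeeze_zero_norm' hbound ?_
  have hc : Tendsto (fun t ↦ M * ‖F t - F p₀‖) (𝓝 p₀) (𝓝 (M * ‖F p₀ - F p₀‖)) :=
    ((hF.continuousAt.sub continuousAt_const).norm).const_mul M
  rw [sub_self, norm_zero, mul_zero] at hc
  exact hc.mono_left nhdsWithin_le_nhds

namespace EndsDatum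

variable [T2Space T] [Nonempty T] (D : EndsDatum T)

omit [IsManifold 𝓘(ℂ, ℂ) ω T] [T2Space T] in
/-- The centred chart coordinate of `T̄` at an old point, read at an old point, is that of `T`. [folklore] -/
theorem coord_inl_inl (p t : T) : coord (D.inl p) (D.inl t) = coord p t := by
  simp only [coord, chartAt_inl, liftChart_inl]

omit [ChartedSpace ℂ T] [IsManifold 𝓘(ℂ, ℂ) ω T] [T2Space T] [Nonempty T] in
/-- A pole estimate on `T̄` at an old point pulls back to `T`. [folklore] -/
theorem eventually_nhdsNE_inl {P : D.Cpt → Prop} {p : T} (h : ∀ᶠ x in 𝓝[≠] (D.inl p), P x) :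
    ∀ᶠ t in 𝓝[≠] p, P (D.inl t) := by
  have ht : Tendsto D.inl (𝓝[≠] p) (𝓝[≠] (D.inl p)) := by
    refine tendsto_nhdsWithin_of_tendsto_nhds_of_eventually_within _
      ((D.continuous_inl.tendsto p).mono_left nhdsWithin_le_nhds) ?_
    filter_upwards [eventually_mem_nhdsWithin] with t ht
    exact fun heq ↦ ht (D.inl_injective heq)
  exact ht.eventually h

/-- **A continuous function of polynomial growth separating a fibre** (the function-theoretic input of
the curve case of Riemann's existence theorem): for holomorphic ends data `D` on a Riemann surface `T`
and a value `c₀`, there is `h : T → ℂ` continuous, holomorphic off a finite set, injective on the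
fibre `F⁻¹{c₀}` and with `|h| ≤ C₀ (1 + |F|)^K`. [cite: Forster1981, §14 Thm. 14.12 and §8 Thm. 8.3]
[cite: SGA1, Exp. XII Thm. 5.1] -/
theorem exists_continuous_injOn_growth (hD : D.IsHolomorphic) (c₀ : ℂ) :
    ∃ (h : T → ℂ) (P : Finset T) (C₀ : ℝ) (K : ℕ), Continuous h ∧
      (∀ t ∉ P, MDifferentiableAt 𝓘(ℂ, ℂ) 𝓘(ℂ, ℂ) h t) ∧ InjOn h (D.F ⁻¹' {c₀}) ∧
      ∀ t, ‖h t‖ ≤ C₀ * (1 + ‖D.F t‖) ^ K := by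
  classical
  haveI := isManifold hD
  -- Step 1: a meromorphic function on `T̄` separating the fibre, holomorphic there and at the new points
  set A : Finset D.Cpt := (D.finite_fibre c₀).toFinset.image D.inl with hA
  obtain ⟨g, Pl, hdisj, hg, hinj, hpole⟩ :=
    exists_mdifferentiable_injOn (M := D.Cpt) A (Set.finite_range D.infty)
  have hmemA : ∀ t, D.F t = c₀ → D.inl t ∈ A := fun t ht ↦
    Finset.mem_image.2 ⟨t, (D.finite_fibre c₀).mem_toFinset.2 ht, rfl⟩
  have hPl_inl : ∀ x ∈ Pl, ∃ p, x = D.inl p := by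
    intro x hx
    rcases D.inl_or_infty x with h | ⟨K, rfl⟩
    · exact h
    · exact absurd (mem_range_self K) (disjoint_left.1 hdisj (Finset.mem_coe.2 hx) ∘ Or.inr)
  have hinfty : ∀ K, D.infty K ∉ Pl := fun K hK ↦
    disjoint_left.1 hdisj (Finset.mem_coe.2 hK) (Or.inr (mem_range_self K))
  -- Step 2: the poles as old points, their orders
  set polesT : Finset T := Pl.preimage D.inl (D.inl_injective.injOn) with hpolesT
  have hmem_polesT : ∀ {p}, p ∈ polesT ↔ D.inl p ∈ Pl := fun {p} ↦ Finset.mem_preimage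
  have hpole_ne : ∀ p ∈ polesT, D.F p ≠ c₀ := fun p hp hc ↦
    disjoint_left.1 hdisj (Finset.mem_coe.2 (hmem_polesT.1 hp)) (Or.inl (Finset.mem_coe.2 (hmemA p hc)))
  have hpole' : ∀ p : T, ∃ (N : ℕ) (C : ℝ), D.inl p ∈ Pl →
      ∀ᶠ x in 𝓝[≠] (D.inl p), ‖g x‖ ≤ C * ‖coord (D.inl p) x‖⁻¹ ^ N := by
    intro p
    by_cases hp : D.inl p ∈ Pl
    · obtain ⟨N, C, h⟩ := hpole _ hp
      exact ⟨N, C, fun _ ↦ h⟩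
    · exact ⟨0, 0, fun h ↦ absurd h hp⟩
  choose N C hNC using hpole'
  -- `g ∘ inl` is holomorphic off the poles
  set gT : T → ℂ := fun t ↦ g (D.inl t) with hgT
  have hgT_md : ∀ t ∉ polesT, MDifferentiableAt 𝓘(ℂ, ℂ) 𝓘(ℂ, ℂ) gT t := fun t ht ↦
    hD.mdifferentiableAt_comp_inl_iff.2 (hg _ fun h ↦ ht (hmem_polesT.2 h))
  have hF_md : MDifferentiable 𝓘(ℂ, ℂ) 𝓘(ℂ, ℂ) D.F := hD.mdifferentiable
  -- Step 3: the function `h`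
  set π : T → ℂ := fun t ↦ ∏ p ∈ polesT, (D.F t - D.F p) ^ (N p + 1) with hπ
  have hπ_cont : Continuous π :=
    continuous_finsetProd _ fun p _ ↦ (D.continuous.sub continuous_const).pow _
  set h : T → ℂ := fun t ↦ if t ∈ polesT then 0 else gT t * π t with hh
  have h_of_notMem : ∀ {t}, t ∉ polesT → h t = gT t * π t := fun {t} ht ↦ by simp only [hh, ht, if_false]
  have hclosed : IsClosed (↑polesT : Set T) := polesT.finite_toSet.isClosed
  have hev_notMem : ∀ {t₀}, t₀ ∉ polesT → ∀ᶠ t in 𝓝 t₀, t ∉ polesT := fun {t₀} ht₀ ↦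
    hclosed.isOpen_compl.mem_nhds ht₀
  have hev_eq : ∀ {t₀}, t₀ ∉ polesT → h =ᶠ[𝓝 t₀] fun t ↦ gT t * π t := fun {t₀} ht₀ ↦
    (hev_notMem ht₀).mono fun t ht ↦ h_of_notMem ht
  -- holomorphy off the poles
  have h_md : ∀ t ∉ polesT, MDifferentiableAt 𝓘(ℂ, ℂ) 𝓘(ℂ, ℂ) h t := by
    intro t₀ ht₀
    refine MDifferentiableAt.congr_of_eventuallyEq ?_ (hev_eq ht₀)
    refine mdifferentiableAt_of_differentiableAt_comp_symm ?_
    have h1 : DifferentiableAt ℂ (gT ∘ (chartAt ℂ t₀).symm) (chartAt ℂ t₀ t₀) :=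
      differentiableAt_comp_symm (mem_chart_source ℂ t₀) (hgT_md t₀ ht₀)
    have h2 : DifferentiableAt ℂ (D.F ∘ (chartAt ℂ t₀).symm) (chartAt ℂ t₀ t₀) :=
      differentiableAt_comp_symm (mem_chart_source ℂ t₀) (hF_md t₀)
    have h3 : DifferentiableAt ℂ (fun z ↦ ∏ p ∈ polesT, ((D.F ∘ (chartAt ℂ t₀).symm) z - D.F p) ^ (N p + 1))
        (chartAt ℂ t₀ t₀) :=
      DifferentiableAt.fun_finsetProd fun p _ ↦ (h2.sub_const _).pow _
    exact h1.mul h3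
  -- continuity
  have h_cont : Continuous h := by
    rw [continuous_iff_continuousAt]
    intro t₀
    by_cases ht₀ : t₀ ∈ polesT
    · -- at a pole: `h → 0 = h t₀`
      have hval : h t₀ = 0 := by simp only [hh, ht₀, if_true]
      rw [← continuousWithinAt_compl_self, ContinuousWithinAt, hval]
      have hPl₀ : D.inl t₀ ∈ Pl := hmem_polesT.1 ht₀
      -- pull the pole estimate back to `T`
      have hgb : ∀ᶠ t in 𝓝[≠] t₀, ‖gT t‖ ≤ C t₀ * ‖coord t₀ t‖⁻¹ ^ N t₀ := by
        have h1 := D.eventually_nhdsNE_inl (hNC t₀ hPl₀)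
        exact h1.mono fun t ht ↦ by rwa [coord_inl_inl] at ht
      set π' : T → ℂ := fun t ↦ ∏ p ∈ polesT.erase t₀, (D.F t - D.F p) ^ (N p + 1) with hπ'
      have hπ'_cont : Continuous π' :=
        continuous_finsetProd _ fun p _ ↦ (D.continuous.sub continuous_const).pow _
      have hlim := tendsto_zero_of_pole_bound hgb (hF_md t₀) hπ'_cont.continuousAt
      refine hlim.congr' ?_
      -- on a punctured neighbourhood, `h = gT · (F − F t₀)^{N+1} · π'`
      have hev : ∀ᶠ t in 𝓝[≠] t₀, t ∉ polesT := by
        have h1 : ∀ᶠ t in 𝓝 t₀, t ∉ polesT.erase t₀ :=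
          (polesT.erase t₀).finite_toSet.isClosed.isOpen_compl.mem_nhds (by simp)
        filter_upwards [mem_nhdsWithin_of_mem_nhds h1, eventually_mem_nhdsWithin] with t ht hne
        exact fun hmem ↦ ht (Finset.mem_erase.2 ⟨hne, hmem⟩)
      have hπ_split : ∀ t, π t = (D.F t - D.F t₀) ^ (N t₀ + 1) * π' t := fun t ↦
        (Finset.mul_prod_erase polesT (fun p ↦ (D.F t - D.F p) ^ (N p + 1)) ht₀).symm
      filter_upwards [hev] with t ht
      rw [h_of_notMem ht, hπ_split]
    · exact ((hgT_md t₀ ht₀).continuousAt.mul hπ_cont.continuousAt).congr_of_eventuallyEq (hev_eq ht₀)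
  -- Step 4: polynomial growth
  set K : ℕ := ∑ p ∈ polesT, (N p + 1) with hK
  have hπ_bound : ∀ t, ‖π t‖ ≤ (∏ p ∈ polesT, (1 + ‖D.F p‖) ^ (N p + 1)) * (1 + ‖D.F t‖) ^ K := by
    intro t
    rw [hπ, norm_prod, hK, ← Finset.prod_pow_eq_pow_sum, ← Finset.prod_mul_distrib]
    refine Finset.prod_le_prod (fun p _ ↦ norm_nonneg _) fun p _ ↦ ?_
    rw [norm_pow, ← mul_pow]
    refine pow_le_pow_left₀ (norm_nonneg _) ?_ _
    calc ‖D.F t - D.F p‖ ≤ ‖D.F t‖ + ‖D.F p‖ := norm_sub_le _ _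
      _ ≤ (1 + ‖D.F p‖) * (1 + ‖D.F t‖) := by nlinarith [norm_nonneg (D.F t), norm_nonneg (D.F p)]
  set Cπ := ∏ p ∈ polesT, (1 + ‖D.F p‖) ^ (N p + 1) with hCπ
  have hCπ0 : 0 ≤ Cπ := Finset.prod_nonneg fun p _ ↦ by positivity
  -- local bounds on the compactification
  have hloc : ∀ x : D.Cpt, ∃ U ∈ 𝓝 x, ∃ Cx : ℝ, ∀ t, D.inl t ∈ U → ‖h t‖ ≤ Cx * (1 + ‖D.F t‖) ^ K := by
    intro x
    rcases D.inl_or_infty x with ⟨t₀, rfl⟩ | ⟨K', rfl⟩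
    · -- near an old point `h` is bounded
      set V : Set T := {t | ‖h t‖ < ‖h t₀‖ + 1} with hV
      have hVopen : IsOpen V := isOpen_lt h_cont.norm continuous_const
      refine ⟨D.inl '' V, (D.isOpenEmbedding_inl.isOpenMap V hVopen).mem_nhds ⟨t₀, by simp [hV], rfl⟩,
        ‖h t₀‖ + 1, fun t ht ↦ ?_⟩
      obtain ⟨s, hs, hst⟩ := ht
      obtain rfl := D.inl_injective hst
      have h1 : (1 : ℝ) ≤ (1 + ‖D.F s‖) ^ K := one_le_pow₀ (by linarith [norm_nonneg (D.F s)])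
      calc ‖h s‖ ≤ ‖h t₀‖ + 1 := le_of_lt hs
        _ ≤ (‖h t₀‖ + 1) * (1 + ‖D.F s‖) ^ K := le_mul_of_one_le_right (by positivity) h1
    · -- near a new point `g` is bounded and there are no poles
      have hgc : ContinuousAt g (D.infty K') := (hg _ (hinfty K')).continuousAt
      have hU₁ : {y | ‖g y‖ < ‖g (D.infty K')‖ + 1} ∈ 𝓝 (D.infty K') :=
        hgc.norm.preimage_mem_nhds (Iio_mem_nhds (lt_add_one _))
      set r : ℝ := ∑ p ∈ polesT, ‖D.F p‖ with hr
      have hr_le : ∀ p ∈ polesT, ‖D.F p‖ ≤ r := fun p hp ↦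
        Finset.single_le_sum (fun p _ ↦ norm_nonneg (D.F p)) hp
      refine ⟨{y | ‖g y‖ < ‖g (D.infty K')‖ + 1} ∩ D.cuspNhd K' r, inter_mem hU₁ (D.cuspNhd_mem_nhds K' r),
        (‖g (D.infty K')‖ + 1) * Cπ, fun t ht ↦ ?_⟩
      obtain ⟨hgt, hct⟩ := ht
      have hgt' : ‖g (D.inl t)‖ < ‖g (D.infty K')‖ + 1 := hgt
      rw [D.inl_mem_cuspNhd_iff] at hct
      have hnot : t ∉ polesT := fun hp ↦ absurd hct.2 (not_lt.2 (hr_le t hp))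
      rw [h_of_notMem hnot, norm_mul, mul_assoc]
      exact mul_le_mul hgt'.le (hπ_bound t) (norm_nonneg _) (by positivity)
  choose U hU Cx hCx using hloc
  obtain ⟨tfin, -, hcover⟩ := isCompact_univ.elim_nhds_subcover U fun x _ ↦ hU x
  set C₀ : ℝ := ∑ x ∈ tfin, max (Cx x) 0 with hC₀
  have hgrowth : ∀ t, ‖h t‖ ≤ C₀ * (1 + ‖D.F t‖) ^ K := by
    intro t
    obtain ⟨x, hx, hxU⟩ : ∃ x ∈ tfin, D.inl t ∈ U x := by
      have h := hcover (mem_univ (D.inl t))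
      simpa only [mem_iUnion, exists_prop] using h
    calc ‖h t‖ ≤ Cx x * (1 + ‖D.F t‖) ^ K := hCx x t hxU
      _ ≤ max (Cx x) 0 * (1 + ‖D.F t‖) ^ K := mul_le_mul_of_nonneg_right (le_max_left _ _) (by positivity)
      _ ≤ C₀ * (1 + ‖D.F t‖) ^ K := by
          refine mul_le_mul_of_nonneg_right ?_ (by positivity)
          exact Finset.single_le_sum (f := fun x ↦ max (Cx x) 0) (fun x _ ↦ le_max_right _ _) hx
  -- Step 5: injectivity on the fibre
  have hinjOn : InjOn h (D.F ⁻¹' {c₀}) := by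
    intro t₁ ht₁ t₂ ht₂ heq
    have hc₁ : D.F t₁ = c₀ := ht₁
    have hc₂ : D.F t₂ = c₀ := ht₂
    have hn₁ : t₁ ∉ polesT := fun hp ↦ hpole_ne t₁ hp hc₁
    have hn₂ : t₂ ∉ polesT := fun hp ↦ hpole_ne t₂ hp hc₂
    have hπeq : π t₁ = π t₂ := by simp only [hπ, hc₁, hc₂]
    have hπne : π t₂ ≠ 0 := by
      rw [hπ, Finset.prod_ne_zero_iff]
      intro p hp
      refine pow_ne_zero _ (sub_ne_zero.2 ?_)
      rw [hc₂]
      exact (hpole_ne p hp).symm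
    rw [h_of_notMem hn₁, h_of_notMem hn₂, hπeq] at heq
    have hgeq : g (D.inl t₁) = g (D.inl t₂) := mul_right_cancel₀ hπne heq
    have h1 := hinj (Finset.mem_coe.2 (hmemA t₁ hc₁)) (Finset.mem_coe.2 (hmemA t₂ hc₂)) hgeq
    exact D.inl_injective h1
  exact ⟨h, polesT, C₀, K, h_cont, h_md, hinjOn, hgrowth⟩

end EndsDatum

end RiemannSurface

end Literature.Geometry.Kaehler
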